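import Mathlib
import Summits.AnomalousDissipation.AnomalousDissipation.Theorems.MarginalStabilityChainBurgersLayerKHLine
import Summits.AnomalousDissipation.AnomalousDissipation.Theorems.MarginalStabilityChainBurgersLayerKHStubStrainedA
import Summits.AnomalousDissipation.AnomalousDissipation.Theorems.MarginalStabilityChainBurgersLayerKHStubVolterraA
import Summits.AnomalousDissipation.AnomalousDissipation.Theorems.MarginalStabilityChainBurgersLayerKHStubModeZero
import Summits.AnomalousDissipation.AnomalousDissipation.Theorems.MarginalStabilityChainBurgersLayerLowReDecay

/-!
# Toolkit for the vortex-sheet limit (stub `stub_sheetLimit`, line `Sketch`), part A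

Crux `MarginalStabilityChain.BurgersLayerKH` (stmt-AnomalousDissipation-3008), line `Sketch`: helper file for the
registered stub `stub_sheetLimit` (the vortex-sheet / long-wave limit of the Rayleigh sheet coefficient;
route and assembly in `…StubSheetLimit.lean`: an exact Wronskian identity for the sheet coefficient plus
a zeroth-order Jost comparison `‖m - m₀‖ = O(α)` from the weighted Volterra theory).

This file (part A): one Gaussian `e^{-y²/8}` dominates every `(1+|y|)^k e^{cy} e^{-y²/4}`
(integrability and decay of everything Gaussian-class); tails `y ↦ ∫_{t>y} f`; a convergent function
with convergent derivative has derivative limit `0`; the profile `U` (derivative, parity, limits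
`±U₊`), the bound `|U''| ≤ e^{-y²/4}`, the denominators `λ + iU(y)`, the Rayleigh potential, and the
Volterra kernel `k_α` (`k_α' = e^{-2αu}`, `0 ≤ k_α(u) ≤ u`, `|k_α(u) - u| ≤ αu²`).  Elementary facts
already in the tree (`U'`, `|U| ≤ |y|`, `|y|e^{-y²/4} ≤ 1`, `k_α(0) = 0`, continuity of `k_α`, tails
`→ 0`) are imported from the sibling stub files `…StubStrainedA`, `…StubVolterraA`, `…StubModeZero` and
from `…BurgersLayerLowReDecay`.
-/

set_option linter.dupNamespace false

noncomputable section

open Complex MeasureTheory Filter Topology Set Metric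

namespace Summit.AnomalousDissipation.AnomalousDissipation.Theorems.BurgersLayerKH.Sheet.SheetLimit

/-! ## A1. Toolkit: one Gaussian dominates every `(1+|y|)^k e^{cy} e^{-y²/4}` -/

/-- Master domination: `(1+|y|)^k e^{cy} e^{-y²/4} ≤ e^{2(k+|c|)²} e^{-y²/8}`. [folklore] -/
theorem polyGauss_le (k : ℕ) (c y : ℝ) :
    (1 + |y|) ^ k * Real.exp (c * y) * Real.exp (-(y ^ 2) / 4) ≤
      Real.exp (2 * ((k : ℝ) + |c|) ^ 2) * Real.exp (-(y ^ 2) / 8) := by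
  have h1 : (1 + |y|) ^ k ≤ Real.exp ((k : ℝ) * |y|) := by
    have : 1 + |y| ≤ Real.exp |y| := by linarith [Real.add_one_le_exp |y|]
    calc (1 + |y|) ^ k ≤ (Real.exp |y|) ^ k := pow_le_pow_left₀ (by positivity) this k
      _ = Real.exp ((k : ℝ) * |y|) := by rw [← Real.exp_nat_mul]
  have h2 : Real.exp (c * y) ≤ Real.exp (|c| * |y|) := by
    apply Real.exp_le_exp.2
    rw [← abs_mul]
    exact le_abs_self _
  have h3 : (k : ℝ) * |y| + |c| * |y| + -(y ^ 2) / 4 ≤ 2 * ((k : ℝ) + |c|) ^ 2 + -(y ^ 2) / 8 := by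
    nlinarith [sq_nonneg (|y| - 4 * ((k : ℝ) + |c|)), abs_nonneg y, abs_nonneg c, sq_abs y]
  calc (1 + |y|) ^ k * Real.exp (c * y) * Real.exp (-(y ^ 2) / 4)
      ≤ Real.exp ((k : ℝ) * |y|) * Real.exp (|c| * |y|) * Real.exp (-(y ^ 2) / 4) := by
        gcongr
    _ = Real.exp ((k : ℝ) * |y| + |c| * |y| + -(y ^ 2) / 4) := by rw [Real.exp_add, Real.exp_add]
    _ ≤ Real.exp (2 * ((k : ℝ) + |c|) ^ 2 + -(y ^ 2) / 8) := Real.exp_le_exp.2 h3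
    _ = _ := by rw [Real.exp_add]

/-- `e^{-y²/8} → 0` at `+∞`. [folklore] -/
theorem tendsto_gauss8_atTop : Tendsto (fun y : ℝ => Real.exp (-(y ^ 2) / 8)) atTop (𝓝 0) := by
  refine Real.tendsto_exp_atBot.comp ?_
  have h1 : Tendsto (fun y : ℝ => y ^ 2 / 8) atTop atTop :=
    (tendsto_pow_atTop two_ne_zero).atTop_div_const (by norm_num)
  refine (tendsto_neg_atTop_atBot.comp h1).congr fun y => ?_
  simp [neg_div]

/-- `e^{-y²/8} → 0` at `-∞`. [folklore] -/
theorem tendsto_gauss8_atBot : Tendsto (fun y : ℝ => Real.exp (-(y ^ 2) / 8)) atBot (𝓝 0) := by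
  refine (tendsto_gauss8_atTop.comp tendsto_neg_atBot_atTop).congr fun y => ?_
  simp

/-- The dominating family is integrable. [folklore] -/
theorem integrable_polyGauss (k : ℕ) (c : ℝ) :
    Integrable (fun y : ℝ => (1 + |y|) ^ k * Real.exp (c * y) * Real.exp (-(y ^ 2) / 4)) := by
  have iG : Integrable (fun y : ℝ =>
      Real.exp (2 * ((k : ℝ) + |c|) ^ 2) * Real.exp (-(1 / 8) * y ^ 2)) :=
    (integrable_exp_neg_mul_sq (by norm_num : (0:ℝ) < 1 / 8)).const_mul _
  refine iG.mono' (Continuous.aestronglyMeasurable (by fun_prop)) (Eventually.of_forall fun y => ?_)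
  rw [Real.norm_of_nonneg (by positivity)]
  calc _ ≤ _ := polyGauss_le k c y
    _ = _ := by congr 1; congr 1; ring

/-- The dominating family tends to `0` at `+∞`. [folklore] -/
theorem tendsto_polyGauss_atTop (k : ℕ) (c : ℝ) :
    Tendsto (fun y : ℝ => (1 + |y|) ^ k * Real.exp (c * y) * Real.exp (-(y ^ 2) / 4)) atTop (𝓝 0) := by
  refine squeeze_zero (fun y => by positivity) (fun y => polyGauss_le k c y) ?_
  simpa using tendsto_gauss8_atTop.const_mul (Real.exp (2 * ((k : ℝ) + |c|) ^ 2))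

/-- The dominating family tends to `0` at `-∞`. [folklore] -/
theorem tendsto_polyGauss_atBot (k : ℕ) (c : ℝ) :
    Tendsto (fun y : ℝ => (1 + |y|) ^ k * Real.exp (c * y) * Real.exp (-(y ^ 2) / 4)) atBot (𝓝 0) := by
  refine squeeze_zero (fun y => by positivity) (fun y => polyGauss_le k c y) ?_
  simpa using tendsto_gauss8_atBot.const_mul (Real.exp (2 * ((k : ℝ) + |c|) ^ 2))

/-- Anything dominated by the family is integrable. [folklore] -/
theorem integrable_of_norm_le_polyGauss {E : Type*} [NormedAddCommGroup E] {F : ℝ → E}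
    (hF : AEStronglyMeasurable F volume) (K : ℝ) (k : ℕ) (c : ℝ)
    (h : ∀ y, ‖F y‖ ≤ K * ((1 + |y|) ^ k * Real.exp (c * y) * Real.exp (-(y ^ 2) / 4))) :
    Integrable F :=
  ((integrable_polyGauss k c).const_mul K).mono' hF (Eventually.of_forall h)

/-- Anything dominated by the family tends to `0` at `+∞`. [folklore] -/
theorem tendsto_zero_atTop_of_norm_le_polyGauss {E : Type*} [NormedAddCommGroup E] {F : ℝ → E}
    (K : ℝ) (k : ℕ) (c : ℝ)
    (h : ∀ y, ‖F y‖ ≤ K * ((1 + |y|) ^ k * Real.exp (c * y) * Real.exp (-(y ^ 2) / 4))) :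
    Tendsto F atTop (𝓝 0) := by
  refine squeeze_zero_norm h ?_
  simpa using (tendsto_polyGauss_atTop k c).const_mul K

/-- Anything dominated by the family tends to `0` at `-∞`. [folklore] -/
theorem tendsto_zero_atBot_of_norm_le_polyGauss {E : Type*} [NormedAddCommGroup E] {F : ℝ → E}
    (K : ℝ) (k : ℕ) (c : ℝ)
    (h : ∀ y, ‖F y‖ ≤ K * ((1 + |y|) ^ k * Real.exp (c * y) * Real.exp (-(y ^ 2) / 4))) :
    Tendsto F atBot (𝓝 0) := by
  refine squeeze_zero_norm h ?_
  simpa using (tendsto_polyGauss_atBot k c).const_mul K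

/-! ## A2. Toolkit: tails `y ↦ ∫_{t > y} f` of an integrable function -/

section Tails

variable {E : Type*} [NormedAddCommGroup E] [NormedSpace ℝ E]

/-- `∫_{Ioi y} f = ∫_{Ioi 0} f - ∫_0^y f`. [folklore] -/
theorem integral_Ioi_eq_sub {f : ℝ → E} (hf : Integrable f) (y : ℝ) :
    ∫ t in Ioi y, f t = (∫ t in Ioi 0, f t) - ∫ t in (0:ℝ)..y, f t := by
  rw [← intervalIntegral.integral_Ioi_sub_Ioi' (hf.integrableOn (s := Ioi 0))
    (hf.integrableOn (s := Ioi y)), sub_sub_cancel]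

/-- Tails of an integrable function depend continuously on the cut. [folklore] -/
theorem continuous_integral_Ioi {f : ℝ → E} (hf : Integrable f) :
    Continuous fun y => ∫ t in Ioi y, f t := by
  rw [show (fun y => ∫ t in Ioi y, f t) = _ from funext (integral_Ioi_eq_sub hf)]
  exact continuous_const.sub
    (intervalIntegral.continuous_primitive (fun a b => hf.intervalIntegrable) 0)

/-- Tails of an integrable function tend to the full integral at `-∞`. [folklore] -/
theorem tendsto_integral_Ioi_atBot {f : ℝ → E} (hf : Integrable f) :
    Tendsto (fun y => ∫ t in Ioi y, f t) atBot (𝓝 (∫ t, f t)) := by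
  rw [show (fun y => ∫ t in Ioi y, f t) = _ from funext (integral_Ioi_eq_sub hf)]
  have h1 := intervalIntegral_tendsto_integral_Iic 0 (hf.integrableOn (s := Iic 0)) tendsto_id
  have h2 : Tendsto (fun y => ∫ t in (0:ℝ)..y, f t) atBot (𝓝 (-∫ t in Iic 0, f t)) := by
    refine h1.neg.congr fun y => ?_
    simp [intervalIntegral.integral_symm (0:ℝ) y]
  have h3 := (tendsto_const_nhds (x := ∫ t in Ioi 0, f t)).sub h2
  rw [sub_neg_eq_add, add_comm, intervalIntegral.integral_Iic_add_Ioi (hf.integrableOn (s := Iic 0))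
    (hf.integrableOn (s := Ioi 0))] at h3
  exact h3

end Tails

/-! ## A3. Toolkit: a convergent function whose derivative converges has derivative limit `0` -/

/-- If `f → c` and `f' → L` at `+∞` then `L = 0`. [folklore] -/
theorem eq_zero_of_tendsto_of_tendsto_deriv {f f' : ℝ → ℂ} {c L : ℂ} (hf : ∀ x, HasDerivAt f (f' x) x)
    (hfc : Tendsto f atTop (𝓝 c)) (hf' : Tendsto f' atTop (𝓝 L)) : L = 0 := by
  by_contra hL
  have hLpos : 0 < ‖L‖ := norm_pos_iff.2 hL
  obtain ⟨N, hN⟩ := eventually_atTop.1 ((Metric.tendsto_nhds.1 hf') (‖L‖ / 2) (by positivity))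
  have hlin : ∀ x : ℝ, HasDerivAt (fun x : ℝ => L * (x : ℂ)) L x := fun x => by
    simpa using ((hasDerivAt_id x).ofReal_comp).const_mul L
  have key : ∀ y ≥ N, ‖(f (y + 1) - f y) - L‖ ≤ ‖L‖ / 2 := by
    intro y hy
    have hmvt := Convex.norm_image_sub_le_of_norm_hasDerivWithin_le
      (f := fun x => f x - L * (x : ℂ)) (f' := fun x => f' x - L) (s := Ici N) (x := y) (y := y + 1)
      (C := ‖L‖ / 2) (fun x _ => ((hf x).sub (hlin x)).hasDerivWithinAt)
      (fun x hx => by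
        have := hN x hx
        rw [dist_eq_norm] at this
        exact this.le)
      (convex_Ici N) hy (by simp only [mem_Ici]; linarith)
    have e : (f (y + 1) - L * ((y + 1 : ℝ) : ℂ)) - (f y - L * (y : ℂ)) = (f (y + 1) - f y) - L := by
      push_cast; ring
    rw [e] at hmvt
    simpa using hmvt
  have h2 : Tendsto (fun y => f (y + 1) - f y) atTop (𝓝 0) := by
    have := (hfc.comp (tendsto_atTop_add_const_right atTop (1:ℝ) tendsto_id)).sub hfc
    simpa using this
  obtain ⟨M, hM⟩ := eventually_atTop.1 ((Metric.tendsto_nhds.1 h2) (‖L‖ / 2) (by positivity))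
  have hy := key (max N M) (le_max_left _ _)
  have hy2 := hM (max N M) (le_max_right _ _)
  rw [dist_zero_right] at hy2
  have : ‖L‖ ≤ ‖f (max N M + 1) - f (max N M)‖ + ‖(f (max N M + 1) - f (max N M)) - L‖ := by
    calc ‖L‖ = ‖(f (max N M + 1) - f (max N M)) - ((f (max N M + 1) - f (max N M)) - L)‖ := by
          congr 1; ring
      _ ≤ _ := norm_sub_le _ _
  linarith

/-! ## A4. The profile `U`, its derivatives, limits and parity -/

/-- `U` as a primitive. [folklore] -/
theorem U_eq : U = fun y => ∫ s in (0:ℝ)..y, Real.exp (-(s ^ 2) / 2) := rfl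

/-- `U` is odd. [folklore] -/
theorem U_neg (y : ℝ) : U (-y) = -U y := by
  have h1 := intervalIntegral.integral_comp_neg (f := fun x : ℝ => Real.exp (-(x ^ 2) / 2))
    (a := y) (b := 0)
  simp only [even_two, Even.neg_pow, neg_zero] at h1
  rw [U_eq]
  simp only
  rw [← h1, intervalIntegral.integral_symm y 0, neg_neg]

/-- `∫_{Ioi 0} e^{-s²/2} ds = U₊ = √(π/2)`. [folklore] -/
theorem integral_Ioi_gauss_half : ∫ s in Ioi (0:ℝ), Real.exp (-(s ^ 2) / 2) = Uinf := by
  have e : (fun s : ℝ => Real.exp (-(s ^ 2) / 2)) = fun x => Real.exp (-(1 / 2) * x ^ 2) := by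
    funext s; congr 1; ring
  rw [e, integral_gaussian_Ioi (1 / 2 : ℝ), Uinf]
  rw [show Real.pi / (1 / 2) = 2 ^ 2 * (Real.pi / 2) by ring, Real.sqrt_mul (by positivity),
    Real.sqrt_sq (by norm_num)]
  ring

/-- The Gaussian `e^{-s²/2}` is integrable. [folklore] -/
theorem integrable_gauss_half : Integrable fun s : ℝ => Real.exp (-(s ^ 2) / 2) := by
  have := integrable_exp_neg_mul_sq (by norm_num : (0:ℝ) < 1 / 2)
  exact this.congr (Eventually.of_forall fun s => by simp only; congr 1; ring)

/-- `U(y) → U₊` as `y → +∞`. [folklore] -/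
theorem tendsto_U_atTop : Tendsto U atTop (𝓝 Uinf) := by
  rw [U_eq, ← integral_Ioi_gauss_half]
  exact intervalIntegral_tendsto_integral_Ioi 0 integrable_gauss_half.integrableOn tendsto_id

/-- `U(y) → -U₊` as `y → -∞`. [folklore] -/
theorem tendsto_U_atBot : Tendsto U atBot (𝓝 (-Uinf)) := by
  refine ((tendsto_U_atTop.comp tendsto_neg_atBot_atTop).neg).congr fun y => ?_
  simp [U_neg]

/-- `(e^{-y²/2})' = U''(y) = -y e^{-y²/2}`. [folklore] -/
theorem hasDerivAt_gauss_half (y : ℝ) : HasDerivAt (fun y : ℝ => Real.exp (-(y ^ 2) / 2)) (Upp y) y := by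
  have := ((hasDerivAt_pow 2 y).fun_neg.div_const 2).exp
  refine this.congr_deriv ?_
  rw [Upp]; push_cast; ring

/-- `U''` is continuous. [folklore] -/
theorem continuous_Upp : Continuous Upp := by
  rw [show Upp = fun y => -(y * Real.exp (-(y ^ 2) / 2)) from rfl]; fun_prop

/-- `|U''(y)| ≤ e^{-y²/4}`. [folklore] -/
theorem abs_Upp_le (y : ℝ) : |Upp y| ≤ Real.exp (-(y ^ 2) / 4) := by
  rw [Upp, abs_neg, abs_mul, abs_of_pos (Real.exp_pos _)]
  have e : Real.exp (-(y ^ 2) / 2) = Real.exp (-(y ^ 2) / 4) * Real.exp (-(y ^ 2) / 4) := by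
    rw [← Real.exp_add]; congr 1; ring
  rw [e, ← mul_assoc]
  have := MarginalStabilityChainBurgersLayerLowRe.abs_mul_exp_quarter_le_one y
  nlinarith [Real.exp_pos (-(y ^ 2) / 4)]

/-! ## A5. Denominators `λ + iU(y)`, `λ ± iU₊` and the Rayleigh potential `V = iU''/(λ + iU)` -/

/-- `re λ ≤ ‖λ + i u‖` for real `u`. [folklore] -/
theorem re_le_norm_add_I_mul (lam : ℂ) (u : ℝ) : lam.re ≤ ‖lam + I * u‖ := by
  have := Complex.re_le_norm (lam + I * u)
  simpa using this

/-- `λ + i u ≠ 0` for real `u` when `re λ > 0`. [folklore] -/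
theorem add_I_mul_ne_zero {lam : ℂ} (hlam : 0 < lam.re) (u : ℝ) : lam + I * u ≠ 0 := by
  intro h
  have := re_le_norm_add_I_mul lam u
  rw [h, norm_zero] at this
  linarith

/-- `λ - iU₊ ≠ 0` when `re λ > 0`. [folklore] -/
theorem sub_I_mul_Uinf_ne_zero {lam : ℂ} (hlam : 0 < lam.re) : lam - I * Uinf ≠ 0 := by
  have := add_I_mul_ne_zero hlam (-Uinf)
  simpa [sub_eq_add_neg] using this

/-- `‖(λ - iU₊)⁻¹‖ ≤ 1/re λ`. [folklore] -/
theorem norm_inv_sub_I_mul_Uinf_le {lam : ℂ} (hlam : 0 < lam.re) : ‖(lam - I * Uinf)⁻¹‖ ≤ 1 / lam.re := by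
  rw [norm_inv, one_div]
  apply inv_anti₀ hlam
  have := re_le_norm_add_I_mul lam (-Uinf)
  simpa [sub_eq_add_neg] using this

/-- The Rayleigh potential is continuous. [folklore] -/
theorem continuous_V {lam : ℂ} (hlam : 0 < lam.re) :
    Continuous fun y : ℝ => I * (Upp y : ℂ) / (lam + I * (U y : ℂ)) := by
  refine Continuous.div (by have := continuous_Upp; fun_prop) (by have := Strained.differentiable_U.continuous; fun_prop)
    (fun y => add_I_mul_ne_zero hlam (U y))

/-- `‖V y‖ ≤ e^{-y²/4}/re λ`. [folklore] -/
theorem norm_V_le {lam : ℂ} (hlam : 0 < lam.re) (y : ℝ) :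
    ‖I * (Upp y : ℂ) / (lam + I * (U y : ℂ))‖ ≤ 1 / lam.re * Real.exp (-(y ^ 2) / 4) := by
  rw [norm_div, norm_mul, Complex.norm_I, one_mul, Complex.norm_real, Real.norm_eq_abs]
  rw [div_le_iff₀ (lt_of_lt_of_le hlam (re_le_norm_add_I_mul lam (U y)))]
  calc |Upp y| ≤ Real.exp (-(y ^ 2) / 4) := abs_Upp_le y
    _ = 1 / lam.re * Real.exp (-(y ^ 2) / 4) * lam.re := by field_simp
    _ ≤ 1 / lam.re * Real.exp (-(y ^ 2) / 4) * ‖lam + I * (U y : ℂ)‖ := by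
        gcongr; exact re_le_norm_add_I_mul lam (U y)

/-! ## A6. The Volterra kernel `k_α` -/

/-- `k_α' = e^{-2αu}`. [folklore] -/
theorem hasDerivAt_volterraKernel (α u : ℝ) :
    HasDerivAt (volterraKernel α) (Real.exp (-(2 * α * u))) u := by
  by_cases hα : α = 0
  · subst hα
    rw [show volterraKernel 0 = fun u => u from funext fun u => by simp [volterraKernel]]
    simpa using hasDerivAt_id' u
  · rw [show volterraKernel α = fun u => (1 - Real.exp (-(2 * α * u))) / (2 * α) from
      funext fun u => by simp [volterraKernel, hα]]
    have h1 : HasDerivAt (fun u : ℝ => -(2 * α * u)) (-(2 * α)) u := by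
      simpa using ((hasDerivAt_id' u).const_mul (2 * α)).fun_neg
    have := ((h1.exp).const_sub 1).div_const (2 * α)
    refine this.congr_deriv ?_
    field_simp

/-- `2α k_α(u) = 1 - e^{-2αu}`. [folklore] -/
theorem two_mul_volterraKernel (α u : ℝ) : 2 * α * volterraKernel α u = 1 - Real.exp (-(2 * α * u)) := by
  by_cases hα : α = 0
  · subst hα; simp [volterraKernel]
  · simp only [volterraKernel, hα, ↓reduceIte]
    field_simp

/-- `0 ≤ k_α(u) ≤ u` and `|k_α(u) - u| ≤ α u²` for `α, u ≥ 0`. [folklore] -/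
theorem volterraKernel_bounds {α : ℝ} (hα : 0 ≤ α) {u : ℝ} (hu : 0 ≤ u) :
    0 ≤ volterraKernel α u ∧ volterraKernel α u ≤ u ∧ |volterraKernel α u - u| ≤ α * u ^ 2 := by
  rcases hα.eq_or_lt with h0 | hpos
  · subst h0; simp [volterraKernel, hu]
  have hne : α ≠ 0 := hpos.ne'
  have hk : volterraKernel α u = (1 - Real.exp (-(2 * α * u))) / (2 * α) := by simp [volterraKernel, hne]
  set x : ℝ := 2 * α * u with hx
  have hx0 : 0 ≤ x := by positivity
  have e1 : 1 - x ≤ Real.exp (-x) := by linarith [Real.add_one_le_exp (-x)]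
  have e2 : Real.exp (-x) ≤ 1 := Real.exp_le_one_iff.2 (by linarith)
  -- second-order bound: `e^{-x} ≤ 1 - x + x²/2` for `x ≥ 0`, via monotonicity of
  -- `g(x) = 1 - x + x²/2 - e^{-x}` (`g(0) = 0`, `g' = -1 + x + e^{-x} ≥ 0`).
  have e3 : Real.exp (-x) ≤ 1 - x + x ^ 2 / 2 := by
    have hg : ∀ s, HasDerivAt (fun s : ℝ => 1 - s + s ^ 2 / 2 - Real.exp (-s)) (-1 + s + Real.exp (-s)) s := by
      intro s
      have := ((((hasDerivAt_id' s).const_sub 1).add ((hasDerivAt_pow 2 s).div_const 2)).sub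
        ((hasDerivAt_id' s).fun_neg.exp))
      refine this.congr_deriv ?_
      simp
    have hmono : MonotoneOn (fun s : ℝ => 1 - s + s ^ 2 / 2 - Real.exp (-s)) (Ici 0) := by
      refine monotoneOn_of_deriv_nonneg (convex_Ici 0) ?_ ?_ ?_
      · exact HasDerivAt.continuousOn fun s _ => hg s
      · exact fun s _ => (hg s).differentiableAt.differentiableWithinAt
      · intro s hs
        rw [interior_Ici, mem_Ioi] at hs
        rw [(hg s).deriv]
        linarith [Real.add_one_le_exp (-s)]
    have := hmono (self_mem_Ici) (mem_Ici.2 hx0) hx0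
    simp at this
    linarith
  have hku : volterraKernel α u ≤ u := by rw [hk, div_le_iff₀ (by positivity)]; linarith
  refine ⟨?_, hku, ?_⟩
  · rw [hk]; exact div_nonneg (by linarith) (by positivity)
  · rw [abs_of_nonpos (by linarith), neg_sub, hk]
    have h2 : u - α * u ^ 2 ≤ (1 - Real.exp (-x)) / (2 * α) := by
      rw [le_div_iff₀ (by positivity)]
      have : x ^ 2 = 4 * α ^ 2 * u ^ 2 := by rw [hx]; ring
      nlinarith
    linarith

/-- Part-A summary (registered sub-goal): the Volterra kernel bounds `0 ≤ k_α(u) ≤ u`,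
`|k_α(u) - u| ≤ α u²` for `α, u ≥ 0`. [folklore] -/
theorem sheetLimit_partA : ∀ α : ℝ, 0 ≤ α → ∀ u : ℝ, 0 ≤ u → 0 ≤ volterraKernel α u ∧ volterraKernel α u ≤ u ∧ |volterraKernel α u - u| ≤ α * u ^ 2 :=
  fun _ hα _ hu => volterraKernel_bounds hα hu

end Summit.AnomalousDissipation.AnomalousDissipation.Theorems.BurgersLayerKH.Sheet.SheetLimit

end
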